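import Literature.NumberTheory.Transcendental.KZRelationsLE
import Literature.NumberTheory.Transcendental.KZMellinFibres
import Literature.NumberTheory.Transcendental.KZLogCalculusProofs
import HarnessLib

/-!
# Gauss multiplication, simplex side: scaling the big simplex onto Dirichlet's representation

Companion of `KZDirichletPeeling.lean` (Kontsevich–Zagier 2001, §1.2; Andrews–Askey–Roy 1999,
Thm 1.5.2, Thm 1.8.1). For `m ≥ 0` and rational `s` the simplex side of the pure-Beta multiplication
family (route item `MultiplicationAccessible` of summit KontsevichZagierPeriods) is the
representation `[S_m, (∏ σ_i · (m+1 - Σ σ_i))^{s-1}]` on the big simplex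
`S_m = {σ > 0, Σ σ < m+1}`; Dirichlet's representation is
`D_m(s; c) = [Δ_m, (∏ u_i^{s-1})(1 - Σ u_i)^{c-1}]` on `Δ_m = {u > 0, Σ u < 1}`. For representations
PINNED by domain and integrand we prove:

* `KZ.bigSimplex_equivalent_constMul_dirichlet` — **scaling**: `[S_m, …] ∼ κ · D_m(s; s)` with
  `κ = (m+1)^{(m+1)s-1}` (`KZ.IntegralRep.constMul`), ONE change of variables `σ = (m+1) u`
  (`|det| = (m+1)^m`; `(∏ σ_i)(m+1 - Σσ_i) = (m+1)^{m+1} (∏ u_i)(1 - Σ u_i)`);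
  `KZ.isAlgebraic_gaussMultConst`, `KZ.gaussMultConst_pos`: `κ` is a positive real algebraic number;
* `KZ.exists_bigSimplexRep` — the big-simplex representation EXISTS as soon as some `D_m(s; s)` does
  (integrability transported along the dilation by Mathlib's Jacobian criterion; for the latter see
  `KZ.exists_dirichletRep` in `KZDirichletPeeling.lean`);
* `KZ.dirichletOne_equivalent_beta` — **base** `D_1(s; c) ∼ β(s, c) = [(0,1), t^{s-1}(1-t)^{c-1}]`;
  `KZ.dirichletZero_equivalent` — `D_0(s; c) ∼ [pt, 1]`.

Everything is proved; no `def`, no named fact.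
-/

noncomputable section

open MeasureTheory Set
open Literature.ModelTheory.ExponentialFields (IsSemialgebraic isSemialgebraic_setOf_eval_pos)
open MvPolynomial (aeval X C)

namespace Literature.NumberTheory.Transcendental

namespace KZ

variable {m : ℕ}

/-! ## The constant `(m+1)^{(m+1)s-1}` -/

/-- A rational power of a natural number is a real algebraic number: `(n^e)^{den e} = n^{num e}`.
[folklore] -/
theorem isAlgebraic_natCast_rpow_ratCast (n : ℕ) (e : ℚ) : IsAlgebraic ℚ ((n : ℝ) ^ (e : ℝ)) := by
  rcases Nat.eq_zero_or_pos n with rfl | hn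
  · rcases eq_or_ne (e : ℝ) 0 with he | he
    · rw [he, Real.rpow_zero]
      exact isAlgebraic_one
    · rw [Nat.cast_zero, Real.zero_rpow he]
      exact isAlgebraic_zero
  · refine IsAlgebraic.of_pow e.den_pos ?_
    rw [← Real.rpow_natCast, ← Real.rpow_mul (Nat.cast_nonneg n),
      show (e : ℝ) * (e.den : ℕ) = ((e.num : ℤ) : ℝ) by exact_mod_cast e.mul_den_eq_num,
      Real.rpow_intCast]
    rcases Int.eq_nat_or_neg e.num with ⟨j, hj | hj⟩ <;> rw [hj]
    · rw [zpow_natCast]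
      exact (isAlgebraic_nat n).pow j
    · rw [zpow_neg, zpow_natCast]
      exact ((isAlgebraic_nat n).pow j).inv

/-- The Gauss multiplication constant `(m+1)^{(m+1)s-1}` is real algebraic. [folklore] -/
theorem isAlgebraic_gaussMultConst (m : ℕ) (s : ℚ) :
    IsAlgebraic ℚ (((m:ℝ) + 1) ^ (((m:ℝ) + 1) * s - 1)) := by
  have h := isAlgebraic_natCast_rpow_ratCast (m + 1) ((m + 1) * s - 1)
  push_cast at h
  exact h

/-- The Gauss multiplication constant `(m+1)^{(m+1)s-1}` is positive. [folklore] -/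
theorem gaussMultConst_pos (m : ℕ) (s : ℚ) : 0 < ((m:ℝ) + 1) ^ (((m:ℝ) + 1) * s - 1) :=
  Real.rpow_pos_of_pos (by positivity) _

/-- The scalar identity behind the scaling `σ = c u` in dimension `m`:
`((∏ c u_i)(c - Σ c u_i))^{e-1} · c^m = c^{(m+1)e-1} · (∏ u_i^{e-1})(1 - Σ u_i)^{e-1}`. [folklore] -/
theorem gaussScaling_identity (m : ℕ) (e : ℝ) {c : ℝ} (hc : 0 < c) {u : Fin m → ℝ}
    (hu : ∀ i, 0 < u i) (hsum : ∑ i, u i < 1) :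
    ((∏ i, c * u i) * (c - ∑ i, c * u i)) ^ (e - 1) * c ^ m =
      c ^ (((m:ℝ) + 1) * e - 1) * ((∏ i, (u i) ^ (e - 1)) * (1 - ∑ i, u i) ^ (e - 1)) := by
  have hP : 0 ≤ ∏ i, u i := Finset.prod_nonneg fun i _ => (hu i).le
  have hS : 0 ≤ 1 - ∑ i, u i := sub_nonneg.2 hsum.le
  have h1 : (∏ i, c * u i) * (c - ∑ i, c * u i) = c ^ (m + 1) * ((∏ i, u i) * (1 - ∑ i, u i)) := by
    rw [Finset.prod_mul_distrib, Fin.prod_const, ← Finset.mul_sum]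
    ring
  have h2 : (c ^ (m + 1)) ^ (e - 1) * c ^ m = c ^ (((m:ℝ) + 1) * e - 1) := by
    rw [← Real.rpow_natCast c (m + 1), ← Real.rpow_mul hc.le, ← Real.rpow_natCast c m,
      ← Real.rpow_add hc]
    congr 1
    push_cast
    ring
  rw [h1, Real.mul_rpow (pow_nonneg hc.le _) (mul_nonneg hP hS), Real.mul_rpow hP hS,
    ← Real.finsetProd_rpow _ _ (fun i _ => (hu i).le), ← h2]
  ring

/-! ## Scaling the big simplex onto the standard one -/

/-- The dilation `u ↦ (m+1) u` maps `Δ_m` ONTO the big simplex `S_m`. [folklore] -/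
theorem image_smul_stdSimplex (m : ℕ) :
    (fun u : Fin m → ℝ => ((m:ℝ) + 1) • u) '' {u | (∀ i, 0 < u i) ∧ ∑ i, u i < 1} =
      {x | (∀ i, 0 < x i) ∧ ∑ i, x i < (m:ℝ) + 1} := by
  have hc : (0:ℝ) < (m:ℝ) + 1 := by positivity
  ext x
  constructor
  · rintro ⟨u, ⟨hpos, hsum⟩, rfl⟩
    refine ⟨fun i => ?_, ?_⟩
    · simp only [Pi.smul_apply, smul_eq_mul]
      exact mul_pos hc (hpos i)
    · simp only [Pi.smul_apply, smul_eq_mul]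
      rw [← Finset.mul_sum]
      have := mul_lt_mul_of_pos_left hsum hc
      linarith
  · rintro ⟨hpos, hsum⟩
    refine ⟨fun i => x i / ((m:ℝ) + 1), ⟨fun i => div_pos (hpos i) hc, ?_⟩, ?_⟩
    · rw [← Finset.sum_div, div_lt_one hc]
      exact hsum
    · funext i
      simp only [Pi.smul_apply, smul_eq_mul]
      rw [mul_div_cancel₀ _ hc.ne']

/-- `det (c • id) = c^m` on `ℝ^m`. [folklore] -/
theorem det_smul_id_fin (m : ℕ) (c : ℝ) : (c • ContinuousLinearMap.id ℝ (Fin m → ℝ)).det = c ^ m := by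
  have h : ((c • ContinuousLinearMap.id ℝ (Fin m → ℝ) : (Fin m → ℝ) →L[ℝ] (Fin m → ℝ)) :
      (Fin m → ℝ) →ₗ[ℝ] (Fin m → ℝ)) = c • LinearMap.id := rfl
  change LinearMap.det ((c • ContinuousLinearMap.id ℝ (Fin m → ℝ) : (Fin m → ℝ) →L[ℝ] (Fin m → ℝ)) :
      (Fin m → ℝ) →ₗ[ℝ] (Fin m → ℝ)) = _
  rw [h, LinearMap.det_smul, LinearMap.det_id, Module.finrank_fin_fun, mul_one]

/-- The big simplex `S_m = {σ > 0, Σ σ < m+1}` is `ℚ`-semialgebraic. [folklore] -/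
theorem isSemialgebraic_bigSimplex (m : ℕ) :
    IsSemialgebraic ℚ {x : Fin m → ℝ | (∀ i, 0 < x i) ∧ ∑ i, x i < (m:ℝ) + 1} := by
  have h := isSemialgebraic_setOf_forall_aeval_pos
    (Fin.snoc (fun i => X i) (C ((m:ℚ) + 1) - ∑ i, X i) : Fin (m + 1) → MvPolynomial (Fin m) ℚ)
  convert h using 1
  ext x
  simp only [mem_setOf_eq, Fin.forall_fin_succ', Fin.snoc_castSucc, Fin.snoc_last, map_sub, map_sum,
    MvPolynomial.aeval_X, MvPolynomial.aeval_C, eq_ratCast, Rat.cast_add, Rat.cast_natCast,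
    Rat.cast_one, sub_pos]

/-- The big-simplex integrand `((∏ σ_i)(m+1 - Σσ_i))^{s-1}` is `ℚ`-semialgebraic on `S_m` (one
Euler–Mellin factor). [folklore] -/
theorem isSemialgebraicFunOn_bigSimplexFun (m : ℕ) (s : ℚ) :
    IsSemialgebraicFunOn ℚ {x : Fin m → ℝ | (∀ i, 0 < x i) ∧ ∑ i, x i < (m:ℝ) + 1}
      (fun x => ((∏ i, x i) * ((m:ℝ) + 1 - ∑ i, x i)) ^ ((s:ℝ) - 1)) := by
  refine (isSemialgebraicFunOn_mellinIntegrand (isSemialgebraic_bigSimplex m)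
    ![(∏ i, X i) * (C ((m:ℚ) + 1) - ∑ i, X i)] ![s - 1] 1 (fun x hx k => ?_)).congr fun x _ => ?_
  · fin_cases k
    simp only [Fin.zero_eta, Matrix.cons_val_zero, map_mul, map_prod, map_sub, map_sum,
      MvPolynomial.aeval_X, MvPolynomial.aeval_C, eq_ratCast, Rat.cast_add, Rat.cast_natCast,
      Rat.cast_one]
    exact mul_pos (Finset.prod_pos fun i _ => hx.1 i) (sub_pos.2 hx.2)
  · simp only [mellinIntegrand_apply, Fin.prod_univ_one, Matrix.cons_val_zero, map_mul, map_prod,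
      map_sub, map_sum, MvPolynomial.aeval_X, MvPolynomial.aeval_C, eq_ratCast, Rat.cast_add,
      Rat.cast_natCast, Rat.cast_one, one_mul, Rat.cast_sub]

/-- **The big-simplex representation exists** as soon as a Dirichlet representation `D_m(s; s)`
does: absolute convergence of `((∏ σ_i)(m+1 - Σσ_i))^{s-1}` on `S_m` is that of
`(m+1)^{(m+1)s-1} · D` pulled through the dilation `σ = (m+1) u`
(`integrableOn_image_iff_integrableOn_abs_det_fderiv_smul`). [cite: AndrewsAskeyRoy1999, Thm 1.8.1] -/
theorem exists_bigSimplexRep (m : ℕ) (s : ℚ) (D : IntegralRep m)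
    (hDd : D.domain = {u | (∀ i, 0 < u i) ∧ ∑ i, u i < 1})
    (hDi : Set.EqOn D.integrand
      (fun u => (∏ i, (u i) ^ ((s:ℝ) - 1)) * (1 - ∑ i, u i) ^ ((s:ℝ) - 1)) D.domain) :
    ∃ P : IntegralRep m, P.domain = {x | (∀ i, 0 < x i) ∧ ∑ i, x i < (m:ℝ) + 1} ∧
      P.integrand = fun x => ((∏ i, x i) * ((m:ℝ) + 1 - ∑ i, x i)) ^ ((s:ℝ) - 1) := by
  have hc : (0:ℝ) < (m:ℝ) + 1 := by positivity
  have hmeas : MeasurableSet {u : Fin m → ℝ | (∀ i, 0 < u i) ∧ ∑ i, u i < 1} :=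
    hDd ▸ IntegralRep.measurableSet_domain_holds D
  have hint : IntegrableOn (fun x : Fin m → ℝ => ((∏ i, x i) * ((m:ℝ) + 1 - ∑ i, x i)) ^ ((s:ℝ) - 1))
      {x | (∀ i, 0 < x i) ∧ ∑ i, x i < (m:ℝ) + 1} := by
    rw [← image_smul_stdSimplex m, integrableOn_image_iff_integrableOn_abs_det_fderiv_smul volume hmeas
      (f := fun u : Fin m → ℝ => ((m:ℝ) + 1) • u)
      (fun u _ => ((hasFDerivAt_id u).const_smul ((m:ℝ) + 1)).hasFDerivWithinAt)
      (fun u _ v _ h => smul_right_injective (Fin m → ℝ) hc.ne' h)]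
    have h1 : IntegrableOn (fun u => ((m:ℝ) + 1) ^ (((m:ℝ) + 1) * s - 1) * D.integrand u)
        {u : Fin m → ℝ | (∀ i, 0 < u i) ∧ ∑ i, u i < 1} := hDd ▸ D.integrableOn.const_mul _
    refine h1.congr_fun (fun u hu => ?_) hmeas
    obtain ⟨hpos, hsum⟩ := hu
    beta_reduce
    rw [hDi (by rw [hDd]; exact ⟨hpos, hsum⟩), smul_eq_mul, det_smul_id_fin, abs_of_pos (pow_pos hc m)]
    simp only [Pi.smul_apply, smul_eq_mul]
    rw [mul_comm (((m:ℝ) + 1) ^ m), gaussScaling_identity m (s:ℝ) hc hpos hsum]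
  exact ⟨⟨_, _, isSemialgebraic_bigSimplex m, isSemialgebraicFunOn_bigSimplexFun m s, hint⟩, rfl, rfl⟩

/-- **Scaling**: a representation pinned as `[S_m, ((∏ σ_i)(m+1 - Σσ_i))^{s-1}]` (the simplex side of
`MultiplicationAccessible`, verbatim) is equivalent to `κ · D` for every `D` pinned as Dirichlet's
`D_m(s; s) = [Δ_m, (∏ u_i^{s-1})(1 - Σu_i)^{s-1}]`, `κ = (m+1)^{(m+1)s-1}`: ONE change of variables
`σ = (m+1) u` (a `ℚ`-linear map, `|det| = (m+1)^m`) from `κ · D` to the big simplex.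
Value identity: `∫_{S_m} = (m+1)^{(m+1)s-1} Γ(s)^{m+1}/Γ((m+1)s)`.
[cite: AndrewsAskeyRoy1999, Thm 1.8.1] -/
theorem bigSimplex_equivalent_constMul_dirichlet (m : ℕ) (s : ℚ) (P D : IntegralRep m)
    (hPd : P.domain = {x | (∀ i, 0 < x i) ∧ ∑ i, x i < (m:ℝ) + 1})
    (hPi : Set.EqOn P.integrand
      (fun x => ((∏ i, x i) * ((m:ℝ) + 1 - ∑ i, x i)) ^ ((s:ℝ) - 1)) P.domain)
    (hDd : D.domain = {u | (∀ i, 0 < u i) ∧ ∑ i, u i < 1})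
    (hDi : Set.EqOn D.integrand
      (fun u => (∏ i, (u i) ^ ((s:ℝ) - 1)) * (1 - ∑ i, u i) ^ ((s:ℝ) - 1)) D.domain)
    (hκ : IsAlgebraic ℚ (((m:ℝ) + 1) ^ (((m:ℝ) + 1) * s - 1))) :
    Equivalent P (D.constMul (((m:ℝ) + 1) ^ (((m:ℝ) + 1) * s - 1)) hκ) := by
  have hc : (0:ℝ) < (m:ℝ) + 1 := by positivity
  have hΔ : IsSemialgebraic ℚ {u : Fin m → ℝ | (∀ i, 0 < u i) ∧ ∑ i, u i < 1} :=
    hDd ▸ D.isSemialgebraic_domain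
  have himage := image_smul_stdSimplex m
  have hmem : of (D.constMul _ hκ) - of P ∈ changeOfVariablesRel := by
    refine ⟨m, D.constMul _ hκ, P, fun u => ((m:ℝ) + 1) • u,
      fun _ => ((m:ℝ) + 1) • ContinuousLinearMap.id ℝ (Fin m → ℝ), ?_,
      fun u _ => ((hasFDerivAt_id u).const_smul ((m:ℝ) + 1)).hasFDerivWithinAt, ?_, ?_,
      fun u hu => ?_, rfl⟩
    · -- semialgebraic: a linear map with rational matrix
      rw [IntegralRep.domain_constMul, hDd]
      refine (isSemialgebraicMapOn_aeval hΔ (fun j => C ((m:ℚ) + 1) * X j)).congr fun u _ => ?_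
      funext j
      simp only [map_mul, MvPolynomial.aeval_C, MvPolynomial.aeval_X, eq_ratCast, Rat.cast_add,
        Rat.cast_natCast, Rat.cast_one, Pi.smul_apply, smul_eq_mul]
    · -- injective
      exact fun u _ v _ h => smul_right_injective (Fin m → ℝ) hc.ne' h
    · -- image
      rw [IntegralRep.domain_constMul, hDd, hPd, himage]
    · -- integrands
      rw [IntegralRep.domain_constMul, hDd] at hu
      obtain ⟨hpos, hsum⟩ := hu
      have hΦu : ((m:ℝ) + 1) • u ∈ P.domain := by
        rw [hPd, ← himage]
        exact mem_image_of_mem _ ⟨hpos, hsum⟩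
      rw [IntegralRep.integrand_constMul]
      show _ * D.integrand u = _
      rw [hDi (by rw [hDd]; exact ⟨hpos, hsum⟩), hPi hΦu, det_smul_id_fin, abs_of_pos (pow_pos hc m)]
      simp only [Pi.smul_apply, smul_eq_mul]
      rw [gaussScaling_identity m (s:ℝ) hc hpos hsum]
  exact Equivalent.symm (changeOfVariablesRel_subset_relations hmem)

/-! ## The bases `D_1(s; c) ∼ β(s, c)` and `D_0(s; c) ∼ [pt, 1]` -/

/-- **Base** `D_1(s; c) ∼ β(s, c)`: the two pinned representations have the same domain
`{0 < u_0, u_0 < 1}` and integrands agreeing on it (congruence, `of_sub_of_mem_relations_of_eqOn`).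
[cite: AndrewsAskeyRoy1999, Def. 1.1.3] -/
theorem dirichletOne_equivalent_beta (s c : ℚ) (D B : IntegralRep 1)
    (hDd : D.domain = {u | (∀ j, 0 < u j) ∧ ∑ j, u j < 1})
    (hDi : Set.EqOn D.integrand
      (fun u => (∏ j, (u j) ^ ((s:ℝ) - 1)) * (1 - ∑ j, u j) ^ ((c:ℝ) - 1)) D.domain)
    (hBd : B.domain = {t | t 0 ∈ Set.Ioo (0:ℝ) 1})
    (hBi : Set.EqOn B.integrand (fun t => (t 0) ^ ((s:ℝ) - 1) * (1 - t 0) ^ ((c:ℝ) - 1)) B.domain) :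
    Equivalent D B := by
  have hd : B.domain = D.domain := by
    rw [hBd, hDd]
    ext t
    simp [Fin.forall_fin_one]
  refine of_sub_of_mem_relations_of_eqOn hd fun t ht => ?_
  rw [hDi ht, hBi (hd ▸ ht)]
  simp

/-- **Degenerate base** `D_0(s; c) ∼ [pt, 1]`: in dimension `0` the Dirichlet domain is the point
`ℝ⁰` and the integrand is `1` on it, so `D_0(s; c)` is congruent to any representation pinned as
`[ℝ⁰, 1]` (e.g. `KZ.IntegralRep.unit` of `KZRulesAssociator`). [folklore] -/
theorem dirichletZero_equivalent (s c : ℚ) (D U : IntegralRep 0)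
    (hDd : D.domain = {u | (∀ j, 0 < u j) ∧ ∑ j, u j < 1})
    (hDi : Set.EqOn D.integrand
      (fun u => (∏ j, (u j) ^ ((s:ℝ) - 1)) * (1 - ∑ j, u j) ^ ((c:ℝ) - 1)) D.domain)
    (hUd : U.domain = Set.univ) (hUi : Set.EqOn U.integrand (fun _ => 1) U.domain) :
    Equivalent D U := by
  have hd : U.domain = D.domain := by
    rw [hUd, hDd]
    ext u
    simp
  refine of_sub_of_mem_relations_of_eqOn hd fun u hu => ?_
  rw [hDi hu, hUi (hd ▸ hu)]
  simp

end KZ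

end Literature.NumberTheory.Transcendental
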